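import Mathlib.Algebra.Homology.DerivedCategory.Ext.Basic
import Mathlib.AlgebraicGeometry.Modules.Sheaf
import Mathlib.Data.Nat.Factorial.Basic
import Literature.AlgebraicGeometry.HodgeTheory.AlgebraicClasses
import Literature.AlgebraicGeometry.HodgeTheory.RationalHodgeClasses
import HarnessLib

/-!
# The semiregularity map (Bloch; Buchweitz–Flenner) of a sheaf and of a closed subscheme

Family `hodge`, layer `Literature/AlgebraicGeometry/HodgeTheory`. Requested by route
`TropicalCuspLift` (items `SemiregularInheritance`, `DepthOneLogLift`, `DeepCuspTropicalVariant`)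
and several idea cards: the SEMIREGULARITY MAP of (a) a closed subscheme `Z ⊆ X` (S. Bloch 1972,
for `Z` a local complete intersection of codimension `p`: `π_Z : H¹(Z, N_{Z/X}) → H^{p+1}(X, Ω^{p-1}_X)`)
and (b) a coherent sheaf / perfect complex `F` (R.-O. Buchweitz and H. Flenner 2003:
`σ = (σ_k)_k : Ext²_X(F, F) → ∏_k H^{k+2}(X, Ω^k_X)`, `σ_k(x) = Tr(x · (-At F)^k) / k!` through the
Atiyah class), together with the predicates "`F` / `Z` is semiregular" (`σ` injective).

## Sources, verbatim

* [BuchweitzFlenner2003] §4 (p. 20 of arXiv:math/9912245): "for every perfect complex `F` there is a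
  natural trace map `Tr : Ext^k_X(F, F ⊗ G) → H^k(X, G)`, `k ≥ 0`, see [Ill]. These maps are
  compatible with taking cup products […] applying the trace map to the Atiyah classes we obtain for
  every perfect complex `F` well defined classes `ch_k(F) := Tr((-1)^k At^k(F))/k! ∈ H^k(X, Λ^k 𝕃_{X/Y})`,
  that are the components of the Chern character". **Definition 4.1**: "Let `X → Y` be a morphism of
  complex spaces and let `F` be a perfect complex of `𝒪_X`-modules. The map
  `σ := Tr(∗ · exp(-At(F))) : Ext²_X(F, F) → ∏_k H^{k+2}(X, Λ^k 𝕃_{X/Y})` is called the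
  semiregularity map for `F`." Before Prop. 4.2: "the group `A := ⊕ A^i` with
  `A^i := ⊕_j Ext^{i+j}_X(F, F ⊗ Λ^j 𝕃)` carries a natural algebra structure that is associative but
  in general not graded commutative". §1: "`At(F) ∈ Ext¹_X(F, F ⊗ Ω¹_X)`, the Atiyah class of `F`.
  Taking powers gives elements `At^q(F) ∈ Ext^q_X(F, F ⊗ Ω^q_X)`"; "`σ_0 : Ext²_X(F, F) → H²(X, 𝒪_X)`
  [is] the map between obstruction spaces for the deformations of `F` versus those of its
  determinant line bundle" (Artamkin, Mukai); "we mean by `k`-semiregular that the component `σ_k` of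
  the semiregularity map for `F` is injective". §5: "`E₀` is called `I`-semiregular if the part of
  the semiregularity map `σ_I : Ext²(E₀, E₀) → ∏_{p ∈ I} H^{p+1}(X₀, Ω^{p-1})` is injective", and
  **Theorem 5.1** (variational Hodge conjecture for `ch_p` of an `I`-semiregular sheaf). §7: "the
  basis of the semiuniversal deformation of `F` is smooth if the semiregularity map `σ` is
  injective". **Definition 4.10**: "`Z ⊆ X` a closed complex subspace […] The composition of the
  canonical map `T²_{Z/X}(𝒪_Z) → Ext²_X(𝒪_Z, 𝒪_Z)` […] with the semiregularity map `σ` […] yields a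
  map `τ : T²_{Z/X}(𝒪_Z) → ∏_{k ≥ 0} H^{k+2}(X, Λ^k 𝕃_{X/Y})`, which we call the semiregularity map
  for `Z`." §8, (8.1): "for a locally complete intersection `T^k_{Z/X}(𝒪_Z) ≅ H^{k-1}(Z, N_{Z/X})`
  […] Bloch's semiregularity map is […] `τ_B : H¹(Z, N_{Z/X}) → H^{q+1}(X, Ω^{q-1}_X)`" (`q` the
  codimension) and **Proposition 8.2**: "The maps `τ_B` and `τ` coincide."
* [BandieraLepriManetti2023] §1: "if `Z` is a (possibly singular) hypersurface in a smooth manifold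
  `X`, its semiregularity map is `σ : H¹(Z, N_{Z|X}) → H²(X, 𝒪_X)` […] `Z` is semiregular if and
  only if the semiregularity map is injective"; "Bloch was able to define a semiregularity map
  `σ : H¹(Z, N_{Z|X}) → H^{p+1}(X, Ω^{p-1}_X)`"; "`τ_k : Ext²_X(F, F) → H^{k+2}(X, Ω^k_X)`,
  `τ_k(x) = ((-1)^k / k!) Tr(At(F)^k x)`, `k ≥ 0` […] called semiregularity maps of `F`; […] when
  `F = 𝒪_Z` with `Z` a locally complete intersection of codimension `p`, then Bloch's
  semiregularity map `σ` is the composition of `τ_{p-1}` with the natural map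
  `H¹(Z, N_{Z|X}) → Ext²_X(𝒪_Z, 𝒪_Z)`."
* [Perry2026Semiregularity] Def. 2.4: "An object `E ∈ 𝒞` is semiregular if the map
  `σ²_E : Ext²_k(E, E) → HH_{-2}(𝒞)` is injective"; Rem. 2.5: for `𝒞 = D_perf(X)`, `X` a smooth
  proper complex variety, `σ²_E` "can be identified (after applying an HKR isomorphism) with the
  semiregularity map of Buchweitz and Flenner".
* [Bloch1972Semiregularity] (S. Bloch, *Semi-regularity and de Rham cohomology*, Invent. Math. 17
  (1972); not held — cite-only, acq-01573; its definition and comparison are quoted from BF §8 and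
  BLM §1 above).
* [VoisinHodgeI2002] Lemma 6.18: "`H^{p,q}(X)` is canonically isomorphic to `H^q(X, Ω^p_X)`" (with
  the Hodge decomposition `H^k(X, ℂ) = ⊕_{p+q=k} H^{p,q}(X)`, (6.1)); [SerreGAGA1956] Thm. 1
  (`H^q(X, Ω^p_X) = H^q(X^an, Ω^p_{X^an})` for `X` projective). BF §5 opens with exactly this
  identification: "its cohomology admits a Hodge decomposition `H^k(X, ℂ) ≅ ⊕_{p+q=k} H^q(X, Ω^p_X)`".

## Content and design (D-0014 hypothesis structures; every `def` below has a body)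

Mathlib (pin v4.32.0) has the abelian category `X.Modules` of `𝒪_X`-modules of a scheme and its
`Ext`-groups (`CategoryTheory.Abelian.Ext`, available here through the smallness fact
`HasExt.standard`), and the tree has `H^q(X, 𝒪_X)`, `Ω¹_{X/k}` (`Motives/Differentials`) and the
Hodge `(p, q)`-types of classes in `Hᵏ(X(ℂ); ℂ)` (`HodgeTheory/RationalHodgeClasses`). It has NO
tensor products `F ⊗ Ω^j`, exterior powers `Ω^j = Λ^j Ω¹`, Atiyah classes, trace maps
`Ext^k(F, F ⊗ G) → H^k(X, G)`, cotangent complexes / tangent cohomology `T^•_{Z/X}`, normal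
sheaves, or Serre duality (searched: `Atiyah`, `atiyahClass`, `traceMap`, `exteriorPower` under
`ModuleCat/Sheaf` and `AlgebraicGeometry`, `normalSheaf`, `conormal` — nothing relevant). Hence,
as the requesting planner anticipated ("an abstract interface (structure carrying Ext², the targets
and σ with its naturality) plus a separate construction statement is acceptable"), the file is
layered:

1. `AtiyahTraceAlgebra 𝕜` — HYPOTHESIS STRUCTURE = exactly the printed ingredients of BF §4 for one
   perfect complex `F` on `X → Y`: the bigraded groups `A^{i,j} = Ext^i_X(F, F ⊗ Λ^j 𝕃_{X/Y})` with
   their associative unital (Yoneda–exterior) product, the groups `H^{i,j} = H^i(X, Λ^j 𝕃_{X/Y})`,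
   the trace maps `Tr : A^{i,j} → H^{i,j}` and the Atiyah class `At(F) ∈ A^{1,1}`. Over it the
   following are REAL definitions by the printed formulas: `atiyahPow k = At(F)^k`,
   `chernCharacter k = ch_k(F) = Tr((-1)^k At^k(F))/k!`, `semiregularityComponent k = σ_k`,
   `semiregularityMap = σ = (σ_k)_k` (Def. 4.1), `IsSemiregular` (`σ` injective; BF §7, Perry
   Def. 2.4), `IsKSemiregular k` (BF §1) and `IsISemiregular I` (BF §5), with the proved relations
   between them and `σ_0 = Tr` (BF §1, Mukai–Artamkin).
2. `SubspaceAtiyahTraceAlgebra 𝕜` — the same for `F = 𝒪_Z`, `Z ⊆ X` closed, plus the group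
   `T²_{Z/X}(𝒪_Z)` and its canonical map `ε²` to `Ext²_X(𝒪_Z, 𝒪_Z)` (BF Def. 4.10); REAL
   definitions `subspaceSemiregularityMap = τ = σ ∘ ε²` and its components
   `blochSemiregularityMap q = τ_q` — for `Z` a local complete intersection of codimension `q + 1`,
   `T²_{Z/X}(𝒪_Z) = H¹(Z, N_{Z/X})` and `τ_q` IS Bloch's `π_Z : H¹(Z, N_{Z/X}) → H^{q+2}(X, Ω^q_X)`
   (BF (8.1) and Prop. 8.2) — and `IsBlochSemiregular q` (`τ_q` injective: Bloch's / Severi's /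
   Kodaira–Spencer's semiregularity, BLM §1).
3. `SemiregularityData n X F` (`X` a `ℂ`-scheme, intended smooth projective of dimension `n`,
   `F : X.left.Modules`) — layer 1 over `ℂ` ANCHORED to the tree's real carriers: `A^{2,0}` is
   Mathlib's `Ext²(F, F)` in `X.Modules`, and `H^{i,j} = H^i(X, Ω^j_X)` is realised inside
   `H^{i+j}(X(ℂ); ℂ) = complexBetti X (i + j)` as the classes of Hodge type `(j, i)` (Dolbeault +
   GAGA + Hodge decomposition, Voisin I Lemma 6.18 — the identification under which BF §5 and
   Perry Thm. 1.1 compare `σ` and `ch` with Hodge classes). REAL definitions over it: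
   `SemiregularityData.sigma k : Ext²(F,F) →+ H^{2k+2}(X(ℂ); ℂ)`, `.chernCharacterBetti k ∈ H^{2k}(X(ℂ); ℂ)`,
   with `isSemiregular_iff` (semiregular iff the Betti-valued `σ` is injective) and the Hodge types
   of `σ_k x` and `ch_k(F)` PROVED from the fields. `SubschemeSemiregularityData n X ι` is the
   analogue of layer 2 for a closed immersion `ι : Z ⟶ X` (`F = ι_* 𝒪_Z`, real:
   `Scheme.Modules.pushforward`).

Intended (and only intended) instances: Illusie's / BF's Atiyah class and trace (BF §3–§4), the
Yoneda product, `T²` of the analytic/algebraic cotangent complex with BF's `ε²` (Lemma 4.9 (1)), and the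
Dolbeault–GAGA isomorphisms. As for `HodgeTheory.GysinFormalism`, consumers take the structure as a
PARAMETER; its existence is a CONSTRUCTION to be supplied (a theory: cotangent complex, Atiyah class
of a perfect complex, Illusie's trace), deliberately NOT vendored as a named fact `Nonempty …`
(D-0026). No theorem ABOUT `σ` is recorded as a field: Bloch's theorem / BF Thm. 5.1–5.2 /
Pridham / BLM Cor. 1.1–1.2 / Perry Thm. 1.1 ("semiregular + Chern character stays Hodge ⇒ deforms,
and the class stays algebraic") are the route's wanted NAMED FACTS and belong in their own files
once relative families (`R^{2k} f_* ℚ`, Gauss–Manin) have carriers; the infinitesimal form needs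
`H¹(X, Θ_X)`, the Kodaira–Spencer class and BF Prop. 4.2/Cor. 4.3
(`σ_k(⟨ξ, -At F⟩) = ⟨ξ, ch_{k+1}(F)⟩`), none of which has a carrier yet. Not here either: the
Hochschild form `Ext²(E,E) → HH_{-2}` (Perry), perfect complexes as objects of `D_perf(X)` (layer 3
takes a sheaf `F : X.Modules`; on a smooth `X` every coherent sheaf is perfect, BF §4 first
sentence), the LOG variant on an snc fibre (route's eventual target), naturality of `σ` under
pull-back (BF Rem. 4.14 (2), "left to the reader" there).

Degrees are explicit equations (`i + i' = a`), never truncated subtraction: Bloch's map for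
codimension `p` is indexed by `q` with `p = q + 1`.
-/

noncomputable section

open CategoryTheory AlgebraicGeometry

universe u v

namespace Literature.AlgebraicGeometry.HodgeTheory

section HodgeTheory

/-! ### Layer 1: the Atiyah–trace algebra of a perfect complex and its semiregularity map -/

/-- **The Atiyah–trace algebra of a perfect complex** `F` on a morphism of complex spaces / schemes
`X → Y` (hypothesis structure, D-0014): the bigraded groups `Ext i j = A^{i,j} = Ext^i_X(F, F ⊗ Λ^j 𝕃_{X/Y})`
(`Λ^j 𝕃_{X/Y} = Ω^j_X` for `X` smooth over a point) with the identity `one = id_F ∈ A^{0,0}` and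
their associative product `mul` ("the group `A` […] carries a natural algebra structure that is
associative but in general not graded commutative" — Yoneda composition followed by the exterior
product `Λ^j ⊗ Λ^{j'} → Λ^{j+j'}`), the cohomology groups `Coh i j = H^i(X, Λ^j 𝕃_{X/Y})`, the trace
maps `trace i j = Tr : Ext^i_X(F, F ⊗ Λ^j 𝕃) → H^i(X, Λ^j 𝕃)` ("see [Ill]") and the Atiyah class
`atiyah = At(F) ∈ Ext¹_X(F, F ⊗ 𝕃_{X/Y})` (BF §3). Everything BF's Definition 4.1 uses, and nothing
else; the semiregularity map is DEFINED from it below.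
[cite: BuchweitzFlenner2003, §4 (trace map, algebra A) and §3 (Atiyah class)] -/
structure AtiyahTraceAlgebra (𝕜 : Type u) [CommRing 𝕜] : Type (max u (v + 1)) where
  /-- `A^{i,j} = Ext^i_X(F, F ⊗ Λ^j 𝕃_{X/Y})`. [cite: BuchweitzFlenner2003, §4 (before Prop. 4.2)] -/
  Ext : ℕ → ℕ → Type v
  /-- [cite: BuchweitzFlenner2003, §4] -/
  [instAddCommGroupExt : ∀ i j, AddCommGroup (Ext i j)]
  /-- [cite: BuchweitzFlenner2003, §4] -/
  [instModuleExt : ∀ i j, Module 𝕜 (Ext i j)]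
  /-- `H^{i,j} = H^i(X, Λ^j 𝕃_{X/Y})` (`= H^i(X, Ω^j_X)` for `X` smooth, `Y` a point).
  [cite: BuchweitzFlenner2003, §4 (trace map)] -/
  Coh : ℕ → ℕ → Type v
  /-- [cite: BuchweitzFlenner2003, §4] -/
  [instAddCommGroupCoh : ∀ i j, AddCommGroup (Coh i j)]
  /-- [cite: BuchweitzFlenner2003, §4] -/
  [instModuleCoh : ∀ i j, Module 𝕜 (Coh i j)]
  /-- The identity `id_F ∈ Ext⁰_X(F, F) = A^{0,0}`, unit of the algebra `A`.
  [cite: BuchweitzFlenner2003, §4 (before Prop. 4.2)] -/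
  one : Ext 0 0
  /-- The product `A^{i,j} × A^{i',j'} → A^{i+i',j+j'}` of the algebra `A` (Yoneda product and
  exterior multiplication). [cite: BuchweitzFlenner2003, §4 (before Prop. 4.2)] -/
  mul {i j i' j' a b : ℕ} (ha : i + i' = a) (hb : j + j' = b) : Ext i j →ₗ[𝕜] Ext i' j' →ₗ[𝕜] Ext a b
  /-- `id_F` is a left unit. [cite: BuchweitzFlenner2003, §4 (before Prop. 4.2)] -/
  one_mul {i j : ℕ} (x : Ext i j) : mul (Nat.zero_add i) (Nat.zero_add j) one x = x
  /-- `id_F` is a right unit. [cite: BuchweitzFlenner2003, §4 (before Prop. 4.2)] -/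
  mul_one {i j : ℕ} (x : Ext i j) : mul (Nat.add_zero i) (Nat.add_zero j) x one = x
  /-- The product is associative ("an algebra structure that is associative").
  [cite: BuchweitzFlenner2003, §4 (before Prop. 4.2)] -/
  mul_assoc {i₁ j₁ i₂ j₂ i₃ j₃ i₁₂ j₁₂ i₂₃ j₂₃ a b : ℕ} (h₁₂ : i₁ + i₂ = i₁₂) (k₁₂ : j₁ + j₂ = j₁₂)
    (h₂₃ : i₂ + i₃ = i₂₃) (k₂₃ : j₂ + j₃ = j₂₃) (ha : i₁₂ + i₃ = a) (hb : j₁₂ + j₃ = b)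
    (ha' : i₁ + i₂₃ = a) (hb' : j₁ + j₂₃ = b) (x : Ext i₁ j₁) (y : Ext i₂ j₂) (z : Ext i₃ j₃) :
    mul ha hb (mul h₁₂ k₁₂ x y) z = mul ha' hb' x (mul h₂₃ k₂₃ y z)
  /-- The trace map `Tr : Ext^i_X(F, F ⊗ Λ^j 𝕃) → H^i(X, Λ^j 𝕃)` (Illusie).
  [cite: BuchweitzFlenner2003, §4 (trace map)] [cite: Illusie1971CotangentI, Ch. V (BF's [Ill])] -/
  trace (i j : ℕ) : Ext i j →ₗ[𝕜] Coh i j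
  /-- The Atiyah class `At(F) ∈ Ext¹_X(F, F ⊗ 𝕃_{X/Y})`. [cite: BuchweitzFlenner2003, §3 and §1] -/
  atiyah : Ext 1 1

namespace AtiyahTraceAlgebra

variable {𝕜 : Type u} [CommRing 𝕜] (A : AtiyahTraceAlgebra.{u, v} 𝕜)

/-- `A^{i,j}` is an abelian group (bundled field). [cite: BuchweitzFlenner2003, §4] -/
instance (i j : ℕ) : AddCommGroup (A.Ext i j) := A.instAddCommGroupExt i j

/-- `A^{i,j}` is a `𝕜`-module (bundled field). [cite: BuchweitzFlenner2003, §4] -/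
instance (i j : ℕ) : Module 𝕜 (A.Ext i j) := A.instModuleExt i j

/-- `H^{i,j}` is an abelian group (bundled field). [cite: BuchweitzFlenner2003, §4] -/
instance (i j : ℕ) : AddCommGroup (A.Coh i j) := A.instAddCommGroupCoh i j

/-- `H^{i,j}` is a `𝕜`-module (bundled field). [cite: BuchweitzFlenner2003, §4] -/
instance (i j : ℕ) : Module 𝕜 (A.Coh i j) := A.instModuleCoh i j

/-- The powers `At^k(F) ∈ Ext^k_X(F, F ⊗ Λ^k 𝕃)` of the Atiyah class ("Taking powers gives elements
`At^q(F) ∈ Ext^q_X(F, F ⊗ Ω^q_X)`"), `At⁰ = id_F`. [cite: BuchweitzFlenner2003, §1 and §4] -/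
def atiyahPow : (k : ℕ) → A.Ext k k
  | 0 => A.one
  | k + 1 => A.mul rfl rfl (atiyahPow k) A.atiyah

/-- `At⁰(F) = id_F`. [cite: BuchweitzFlenner2003, §4] -/
@[simp]
theorem atiyahPow_zero : A.atiyahPow 0 = A.one := rfl

/-- `At^{k+1}(F) = At^k(F) · At(F)`. [cite: BuchweitzFlenner2003, §4] -/
theorem atiyahPow_succ (k : ℕ) : A.atiyahPow (k + 1) = A.mul rfl rfl (A.atiyahPow k) A.atiyah := rfl

/-- `At¹(F) = At(F)`. [cite: BuchweitzFlenner2003, §4] -/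
@[simp]
theorem atiyahPow_one : A.atiyahPow 1 = A.atiyah := by
  rw [atiyahPow_succ, atiyahPow_zero]
  exact A.one_mul A.atiyah

/-- The scalar `(-1)^k / k!` of `exp(-At(F))` in degree `k` (BF and BLM work over `ℂ` / a field of
characteristic `0`; over a general coefficient ring `𝕜` the inverse of `k!` is `Ring.inverse`, i.e.
the honest inverse when `k!` is a unit in `𝕜` — e.g. `p > k` for `𝕜 = W_n(k)` — and Lean's junk
value `0` otherwise). [cite: BuchweitzFlenner2003, Def. 4.1] -/
def expCoeff (k : ℕ) : 𝕜 := (-1 : 𝕜) ^ k * Ring.inverse ((Nat.factorial k : ℕ) : 𝕜)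

/-- `(-1)⁰ / 0! = 1`. [cite: BuchweitzFlenner2003, Def. 4.1] -/
@[simp]
theorem expCoeff_zero : expCoeff (𝕜 := 𝕜) 0 = 1 := by
  simp [expCoeff]

/-- Over a field, `(-1)^k / k!` is the honest quotient. [cite: BuchweitzFlenner2003, Def. 4.1] -/
theorem expCoeff_eq {K : Type u} [Field K] (k : ℕ) :
    expCoeff (𝕜 := K) k = (-1 : K) ^ k * ((Nat.factorial k : ℕ) : K)⁻¹ := by
  rw [expCoeff, Ring.inverse_eq_inv]

/-- The coefficient `(-1)^k / k!` is non-zero in characteristic `0`. [cite: BuchweitzFlenner2003, Def. 4.1] -/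
theorem expCoeff_ne_zero {K : Type u} [Field K] [CharZero K] (k : ℕ) : expCoeff (𝕜 := K) k ≠ 0 := by
  rw [expCoeff_eq]
  refine mul_ne_zero (pow_ne_zero _ (neg_ne_zero.2 one_ne_zero)) (inv_ne_zero ?_)
  exact_mod_cast Nat.factorial_ne_zero k

/-- The **components of the Chern character** `ch_k(F) := Tr((-1)^k At^k(F))/k! ∈ H^k(X, Λ^k 𝕃_{X/Y})`
("the components of the Chern character `ch(F) = Tr exp(-At(F))` of `F`"; the usual Chern
character for a vector bundle on a manifold, Atiyah / O'Brian–Toledo–Tong, and Illusie's in the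
algebraic case). [cite: BuchweitzFlenner2003, §4 (before Def. 4.1)] -/
def chernCharacter (k : ℕ) : A.Coh k k :=
  (expCoeff k : 𝕜) • A.trace k k (A.atiyahPow k)

/-- `ch₀(F) = Tr(id_F)` (the rank). [cite: BuchweitzFlenner2003, §4 (before Def. 4.1)] -/
theorem chernCharacter_zero : A.chernCharacter 0 = A.trace 0 0 A.one := by
  simp [chernCharacter]

/-- The **`k`-th component of the semiregularity map**,
`σ_k : Ext²_X(F, F) → H^{k+2}(X, Λ^k 𝕃_{X/Y})`, `σ_k(x) = Tr(x · (-At(F))^k / k!) = ((-1)^k/k!) Tr(x · At^k(F))`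
(the degree-`k` component of `Tr(∗ · exp(-At(F)))`; BLM: `τ_k(x) = ((-1)^k/k!) Tr(At(F)^k x)`).
[cite: BuchweitzFlenner2003, Def. 4.1] [cite: BandieraLepriManetti2023, §1 (maps τ_k)] -/
def semiregularityComponent (k : ℕ) : A.Ext 2 0 →ₗ[𝕜] A.Coh (k + 2) k :=
  (expCoeff k : 𝕜) •
    (A.trace (k + 2) k ∘ₗ (A.mul (Nat.add_comm 2 k) (Nat.zero_add k)).flip (A.atiyahPow k))

/-- Unfolding: `σ_k(x) = ((-1)^k/k!) · Tr(x · At^k(F))`. [cite: BuchweitzFlenner2003, Def. 4.1] -/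
theorem semiregularityComponent_apply (k : ℕ) (x : A.Ext 2 0) :
    A.semiregularityComponent k x =
      (expCoeff k : 𝕜) •
        A.trace (k + 2) k (A.mul (Nat.add_comm 2 k) (Nat.zero_add k) x (A.atiyahPow k)) :=
  rfl

/-- **`σ_0` is the trace** `Tr : Ext²_X(F, F) → H²(X, 𝒪_X)` ("the work of Artamkin and Mukai
interprets `σ_0 : Ext²_X(F, F) → H²(X, 𝒪_X)` as the map between obstruction spaces for the
deformations of `F` versus those of its determinant line bundle").
[cite: BuchweitzFlenner2003, §1 (σ_0, Artamkin–Mukai)] -/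
theorem semiregularityComponent_zero_apply (x : A.Ext 2 0) :
    A.semiregularityComponent 0 x = A.trace 2 0 x := by
  rw [semiregularityComponent_apply, expCoeff_zero, one_smul, atiyahPow_zero]
  exact congrArg (A.trace 2 0) (A.mul_one x)

/-- **The semiregularity map of `F`** (Buchweitz–Flenner),
`σ := Tr(∗ · exp(-At(F))) : Ext²_X(F, F) → ∏_k H^{k+2}(X, Λ^k 𝕃_{X/Y})`, `σ = (σ_k)_{k ≥ 0}`; for `X`
a complex manifold / smooth variety and `Y` a point the target is `∏_k H^{k+2}(X, Ω^k_X)`.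
[cite: BuchweitzFlenner2003, Def. 4.1] -/
def semiregularityMap : A.Ext 2 0 →ₗ[𝕜] ((k : ℕ) → A.Coh (k + 2) k) :=
  LinearMap.pi A.semiregularityComponent

/-- The `k`-th coordinate of `σ(x)` is `σ_k(x)`. [cite: BuchweitzFlenner2003, Def. 4.1] -/
@[simp]
theorem semiregularityMap_apply (x : A.Ext 2 0) (k : ℕ) :
    A.semiregularityMap x k = A.semiregularityComponent k x :=
  rfl

/-- **`F` is semiregular**: its semiregularity map `σ : Ext²_X(F, F) → ∏_k H^{k+2}(X, Λ^k 𝕃)` is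
injective ("the basis of the semiuniversal deformation of `F` is smooth if the semiregularity map
`σ` is injective"; Perry: "`E` is semiregular if the map `σ²_E` is injective").
[cite: BuchweitzFlenner2003, §1 and §7] [cite: Perry2026Semiregularity, Def. 2.4 and Rem. 2.5] -/
def IsSemiregular (A : AtiyahTraceAlgebra.{u, v} 𝕜) : Prop :=
  Function.Injective A.semiregularityMap

/-- **`F` is `k`-semiregular**: the single component `σ_k : Ext²_X(F, F) → H^{k+2}(X, Λ^k 𝕃)` is
injective ("we mean by `k`-semiregular that the component `σ_k` of the semiregularity map for `F` is
injective"). NB: §5 of the same paper shifts the index by one ("`p`-semiregular": the component to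
`H^{p+1}(X, Ω^{p-1})`, i.e. `σ_{p-1}`, is injective) — here `k` is ALWAYS the form degree.
[cite: BuchweitzFlenner2003, §1 (k-semiregular)] -/
def IsKSemiregular (k : ℕ) : Prop :=
  Function.Injective (A.semiregularityComponent k)

/-- **`F` is `I`-semiregular** for a set `I` of form degrees: the part `σ_I = (σ_k)_{k ∈ I}` of the
semiregularity map is injective, i.e. `x = 0` as soon as `σ_k(x) = 0` for all `k ∈ I` (BF §5, with
their `p ∈ I` ↔ form degree `k = p - 1` here: "`E₀` is called `I`-semiregular if the part of the
semiregularity map `σ_I : Ext²(E₀, E₀) → ∏_{p ∈ I} H^{p+1}(X₀, Ω^{p-1})` is injective").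
[cite: BuchweitzFlenner2003, §5 (I-semiregular, before Thm. 5.1)] -/
def IsISemiregular (I : Set ℕ) : Prop :=
  ∀ x : A.Ext 2 0, (∀ k ∈ I, A.semiregularityComponent k x = 0) → x = 0

/-- Semiregularity in terms of components: `σ` is injective iff `x = 0` whenever all `σ_k(x) = 0`.
[cite: BuchweitzFlenner2003, Def. 4.1] -/
theorem isSemiregular_iff :
    A.IsSemiregular ↔ ∀ x : A.Ext 2 0, (∀ k, A.semiregularityComponent k x = 0) → x = 0 := by
  rw [IsSemiregular, injective_iff_map_eq_zero]
  refine forall_congr' fun x ↦ ⟨fun h hx ↦ h (funext fun k ↦ hx k), fun h hx ↦ h fun k ↦ ?_⟩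
  exact congrFun hx k

/-- `I`-semiregularity for `I = univ` is semiregularity. [cite: BuchweitzFlenner2003, §5] -/
theorem isISemiregular_univ_iff : A.IsISemiregular Set.univ ↔ A.IsSemiregular := by
  rw [isSemiregular_iff]
  exact forall_congr' fun x ↦ ⟨fun h hx ↦ h fun k _ ↦ hx k, fun h hx ↦ h fun k ↦ hx k trivial⟩

/-- `I`-semiregularity for `I = {k}` is `k`-semiregularity. [cite: BuchweitzFlenner2003, §1 and §5] -/
theorem isISemiregular_singleton_iff (k : ℕ) : A.IsISemiregular {k} ↔ A.IsKSemiregular k := by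
  rw [IsKSemiregular, injective_iff_map_eq_zero]
  exact forall_congr' fun x ↦ ⟨fun h hx ↦ h fun k' hk' ↦ by rw [Set.mem_singleton_iff.1 hk']; exact hx,
    fun h hx ↦ h (hx k rfl)⟩

/-- `I`-semiregularity is monotone in `I`: more components can only help.
[cite: BuchweitzFlenner2003, §5] -/
theorem IsISemiregular.mono {A : AtiyahTraceAlgebra.{u, v} 𝕜} {I J : Set ℕ} (hIJ : I ⊆ J)
    (h : A.IsISemiregular I) : A.IsISemiregular J :=
  fun x hx ↦ h x fun k hk ↦ hx k (hIJ hk)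

/-- An `I`-semiregular `F` is semiregular. [cite: BuchweitzFlenner2003, §5] -/
theorem IsISemiregular.isSemiregular {A : AtiyahTraceAlgebra.{u, v} 𝕜} {I : Set ℕ}
    (h : A.IsISemiregular I) : A.IsSemiregular :=
  A.isISemiregular_univ_iff.1 (h.mono (Set.subset_univ I))

/-- A `k`-semiregular `F` is semiregular. [cite: BuchweitzFlenner2003, §1] -/
theorem IsKSemiregular.isSemiregular {A : AtiyahTraceAlgebra.{u, v} 𝕜} {k : ℕ}
    (h : A.IsKSemiregular k) : A.IsSemiregular :=
  ((A.isISemiregular_singleton_iff k).2 h).isSemiregular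

/-- `0`-semiregularity is injectivity of the trace `Tr : Ext²_X(F, F) → H²(X, 𝒪_X)` (the
Mukai–Artamkin case). [cite: BuchweitzFlenner2003, §1 (σ_0, Artamkin–Mukai)] -/
theorem isKSemiregular_zero_iff : A.IsKSemiregular 0 ↔ Function.Injective (A.trace 2 0) := by
  have h : (A.semiregularityComponent 0 : A.Ext 2 0 → A.Coh 2 0) = A.trace 2 0 :=
    funext A.semiregularityComponent_zero_apply
  rw [IsKSemiregular]
  exact Eq.to_iff (congrArg Function.Injective h)

end AtiyahTraceAlgebra

/-! ### Layer 2: closed subspaces — `τ = σ ∘ ε²` and Bloch's map -/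

/-- **The Atiyah–trace algebra of a closed subspace** `Z ⊆ X` (hypothesis structure): the algebra of
the perfect complex `F = 𝒪_Z` (`𝒪_Z` of locally finite projective dimension over `𝒪_X`) together
with the tangent cohomology group `T2 = T²_{Z/X}(𝒪_Z)` — the obstruction space for embedded
deformations of `Z` in `X`; `= H¹(Z, N_{Z/X})` when `Z` is a local complete intersection, (8.1) — and
the canonical map `epsilon = ε² : T²_{Z/X}(𝒪_Z) → Ext²_X(𝒪_Z, 𝒪_Z)` of Lemma 4.9 (1).
[cite: BuchweitzFlenner2003, Def. 4.10 and (8.1)] -/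
structure SubspaceAtiyahTraceAlgebra (𝕜 : Type u) [CommRing 𝕜] extends AtiyahTraceAlgebra.{u, v} 𝕜 where
  /-- `T²_{Z/X}(𝒪_Z)` (`= H¹(Z, N_{Z/X})` for `Z` a local complete intersection).
  [cite: BuchweitzFlenner2003, Def. 4.10 and (8.1)] -/
  T2 : Type v
  /-- [cite: BuchweitzFlenner2003, Def. 4.10] -/
  [instAddCommGroupT2 : AddCommGroup T2]
  /-- [cite: BuchweitzFlenner2003, Def. 4.10] -/
  [instModuleT2 : Module 𝕜 T2]
  /-- The canonical map `ε² : T²_{Z/X}(𝒪_Z) → Ext²_X(𝒪_Z, 𝒪_Z)` (for `Z` lci, BLM: "the natural map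
  `H¹(Z, N_{Z|X}) → Ext²_X(𝒪_Z, 𝒪_Z)`").
  [cite: BuchweitzFlenner2003, Def. 4.10 and Lemma 4.9 (1)] [cite: BandieraLepriManetti2023, §1] -/
  epsilon : T2 →ₗ[𝕜] Ext 2 0

namespace SubspaceAtiyahTraceAlgebra

variable {𝕜 : Type u} [CommRing 𝕜] (B : SubspaceAtiyahTraceAlgebra.{u, v} 𝕜)

/-- `T²_{Z/X}(𝒪_Z)` is an abelian group (bundled field). [cite: BuchweitzFlenner2003, Def. 4.10] -/
instance : AddCommGroup B.T2 := B.instAddCommGroupT2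

/-- `T²_{Z/X}(𝒪_Z)` is a `𝕜`-module (bundled field). [cite: BuchweitzFlenner2003, Def. 4.10] -/
instance : Module 𝕜 B.T2 := B.instModuleT2

/-- **The semiregularity map of the closed subspace `Z ⊆ X`**,
`τ := σ ∘ ε² : T²_{Z/X}(𝒪_Z) → ∏_{k ≥ 0} H^{k+2}(X, Λ^k 𝕃_{X/Y})`. [cite: BuchweitzFlenner2003, Def. 4.10] -/
def subspaceSemiregularityMap : B.T2 →ₗ[𝕜] ((k : ℕ) → B.Coh (k + 2) k) :=
  B.semiregularityMap ∘ₗ B.epsilon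

/-- **Bloch's semiregularity map** in form degree `q`: the component
`τ_q = σ_q ∘ ε² : T²_{Z/X}(𝒪_Z) → H^{q+2}(X, Λ^q 𝕃_{X/Y})`. For `Z` a local complete intersection of
codimension `p = q + 1` in a compact complex manifold `X` this IS Bloch's
`π_Z = τ_B : H¹(Z, N_{Z/X}) → H^{p+1}(X, Ω^{p-1}_X)` (BF Prop. 8.2: "The maps `τ_B` and `τ`
coincide"; BLM: "Bloch's semiregularity map `σ` is the composition of `τ_{p-1}` with the natural map
`H¹(Z, N_{Z|X}) → Ext²_X(𝒪_Z, 𝒪_Z)`"); for `Z` a hypersurface (`q = 0`) it is Severi's /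
Kodaira–Spencer's `H¹(Z, N_{Z|X}) → H²(X, 𝒪_X)`.
[cite: BuchweitzFlenner2003, (8.1)(2) and Prop. 8.2] [cite: Bloch1972Semiregularity, §4–§6 (cite-only; via BF Prop. 8.2)]
[cite: BandieraLepriManetti2023, §1] -/
def blochSemiregularityMap (q : ℕ) : B.T2 →ₗ[𝕜] B.Coh (q + 2) q :=
  B.semiregularityComponent q ∘ₗ B.epsilon

/-- The `q`-th coordinate of `τ(t)` is Bloch's `τ_q(t)`. [cite: BuchweitzFlenner2003, Def. 4.10] -/
@[simp]
theorem subspaceSemiregularityMap_apply (t : B.T2) (q : ℕ) :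
    B.subspaceSemiregularityMap t q = B.blochSemiregularityMap q t :=
  rfl

/-- Unfolding: `τ_q(t) = σ_q(ε² t)`. [cite: BuchweitzFlenner2003, Def. 4.10 and Prop. 8.2] -/
theorem blochSemiregularityMap_apply (q : ℕ) (t : B.T2) :
    B.blochSemiregularityMap q t = B.semiregularityComponent q (B.epsilon t) :=
  rfl

/-- **`Z` is semiregular in the sense of Bloch** (form degree `q`, i.e. codimension `q + 1` in the
lci case): Bloch's map `τ_q` is injective ("`Z` is semiregular if and only if the semiregularity map
is injective"; Bloch: "the injectivity of `τ` implies that `[Z]` is a smooth point of `H_X`").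
[cite: BandieraLepriManetti2023, §1] [cite: BuchweitzFlenner2003, §1] [cite: Bloch1972Semiregularity, §4–§6 (cite-only)] -/
def IsBlochSemiregular (q : ℕ) : Prop :=
  Function.Injective (B.blochSemiregularityMap q)

/-- **`Z` is semiregular** (BF's sense for subspaces): `τ = σ ∘ ε²` is injective.
[cite: BuchweitzFlenner2003, Def. 4.10 and §7] -/
def IsSubspaceSemiregular (B : SubspaceAtiyahTraceAlgebra.{u, v} 𝕜) : Prop :=
  Function.Injective B.subspaceSemiregularityMap

/-- Bloch-semiregular in some degree implies semiregular as a subspace. [cite: BuchweitzFlenner2003, §5 (I-semiregular subspaces)] -/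
theorem IsBlochSemiregular.isSubspaceSemiregular {B : SubspaceAtiyahTraceAlgebra.{u, v} 𝕜} {q : ℕ}
    (h : B.IsBlochSemiregular q) : B.IsSubspaceSemiregular :=
  fun t t' htt' ↦ h (by simpa using congrFun htt' q)

end SubspaceAtiyahTraceAlgebra

/-! ### Layer 3: smooth projective complex varieties — real `Ext²` and Hodge realisation of the targets -/

/-- The `Ext`-groups `Extⁿ(M, N)` of `𝒪_Y`-modules (Mathlib's `CategoryTheory.Abelian.Ext` in the
abelian category `Y.Modules`) exist as types in `Type (u + 1)`: morphisms between single complexes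
in the derived category of ANY abelian category `C : Type u'` with `Category.{v'} C` are
`max u' v'`-small (Mathlib `HasExt.standard`); here `u' = u + 1`, `v' = u`. A `Prop`-valued
instance (no data), registered so that `Abelian.Ext M N n` elaborates for sheaves of modules on a
scheme. [folklore] -/
instance Modules.hasExt (Y : Scheme.{u}) : HasExt.{u + 1} Y.Modules :=
  HasExt.standard _

/-- **Hodge realisation of the coherent cohomology of the `Ω^j`** (hypothesis structure): for a
smooth projective complex variety `X` of dimension `n` and groups `H i j` standing for
`H^i(X, Ω^j_X)`, the injections `H^i(X, Ω^j_X) ≅ H^{j,i}(X) ⊆ H^{i+j}(X(ℂ); ℂ)` onto the classes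
of Hodge type `(j, i)` in the tree's `complexBetti X (i + j)` / `IsOfHodgeType n X` — GAGA
(`H^i(X, Ω^j_X) = H^i(X^an, Ω^j_{X^an})`), Dolbeault, and "`H^{p,q}(X)` is canonically isomorphic
to `H^q(X, Ω^p_X)`" inside the Hodge decomposition `H^k(X, ℂ) = ⊕_{p+q=k} H^{p,q}(X)`; the
identification with which BF §5 opens ("`H^k(X, ℂ) ≅ ⊕_{p+q=k} H^q(X, Ω^p_X)`").
[cite: VoisinHodgeI2002, Lemma 6.18 and (6.1)] [cite: SerreGAGA1956, Thm. 1] [cite: BuchweitzFlenner2003, §5 (first paragraph)] -/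
structure HodgeRealization (n : ℕ) (X : Motives.SchemeOver ℂ) (H : ℕ → ℕ → Type v)
    [∀ i j, AddCommGroup (H i j)] [∀ i j, Module ℂ (H i j)] where
  /-- `H^i(X, Ω^j_X) → H^{i+j}(X(ℂ); ℂ)` (`j + i = m`). [cite: VoisinHodgeI2002, Lemma 6.18] -/
  toBetti {i j m : ℕ} (h : j + i = m) : H i j →ₗ[ℂ] complexBetti X m
  /-- The realisation is injective (`⊕ H^{p,q} → H^k(X, ℂ)` is an isomorphism).
  [cite: VoisinHodgeI2002, (6.1) and Lemma 6.18] -/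
  injective_toBetti {i j m : ℕ} (h : j + i = m) : Function.Injective (toBetti h)
  /-- Its image consists of classes of Hodge type `(j, i)` … [cite: VoisinHodgeI2002, Lemma 6.18] -/
  isOfHodgeType_toBetti {i j m : ℕ} (h : j + i = m) (y : H i j) : IsOfHodgeType n X m j i (toBetti h y)
  /-- … and exhausts them (`H^{j,i}(X) ≅ H^i(X, Ω^j_X)`). [cite: VoisinHodgeI2002, Lemma 6.18] [cite: SerreGAGA1956, Thm. 1] -/
  exists_toBetti_eq {i j m : ℕ} (h : j + i = m) {c : complexBetti X m}
    (hc : IsOfHodgeType n X m j i c) : ∃ y : H i j, toBetti h y = c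

namespace HodgeRealization

variable {n : ℕ} {X : Motives.SchemeOver ℂ} (A : AtiyahTraceAlgebra.{0, v} ℂ)
  (R : HodgeRealization.{v} n X A.Coh)

/-- `σ_k` followed by the Hodge realisation: `Ext²_X(F, F) → H^{k+2}(X, Ω^k_X) ↪ H^{2k+2}(X(ℂ); ℂ)`.
[cite: BuchweitzFlenner2003, Def. 4.1 and §5 (first paragraph)] -/
def sigmaBetti (k : ℕ) : A.Ext 2 0 →ₗ[ℂ] complexBetti X (2 * k + 2) :=
  R.toBetti (show k + (k + 2) = 2 * k + 2 by omega) ∘ₗ A.semiregularityComponent k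

/-- Unfolding of `sigmaBetti`. [cite: BuchweitzFlenner2003, Def. 4.1] -/
theorem sigmaBetti_apply (k : ℕ) (x : A.Ext 2 0) :
    R.sigmaBetti A k x =
      R.toBetti (show k + (k + 2) = 2 * k + 2 by omega) (A.semiregularityComponent k x) :=
  rfl

/-- `σ_k(x)`, read in `H^{2k+2}(X(ℂ); ℂ)`, is of Hodge type `(k, k + 2)`
(`H^{k+2}(X, Ω^k_X) = H^{k,k+2}(X)`). [cite: BuchweitzFlenner2003, §5 (first paragraph)] [cite: VoisinHodgeI2002, Lemma 6.18] -/
theorem isOfHodgeType_sigmaBetti (k : ℕ) (x : A.Ext 2 0) :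
    IsOfHodgeType n X (2 * k + 2) k (k + 2) (R.sigmaBetti A k x) :=
  R.isOfHodgeType_toBetti _ _

/-- `F` is semiregular iff `x ↦ (σ_k(x))_k ∈ ∏_k H^{2k+2}(X(ℂ); ℂ)` is injective (the realisation is
injective). [cite: BuchweitzFlenner2003, Def. 4.1 and §7] -/
theorem isSemiregular_iff_sigmaBetti :
    A.IsSemiregular ↔ ∀ x : A.Ext 2 0, (∀ k, R.sigmaBetti A k x = 0) → x = 0 := by
  rw [A.isSemiregular_iff]
  refine forall_congr' fun x ↦ ⟨fun h hx ↦ h fun k ↦ ?_, fun h hx ↦ h fun k ↦ ?_⟩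
  · exact R.injective_toBetti (show k + (k + 2) = 2 * k + 2 by omega) (by rw [map_zero]; exact hx k)
  · rw [sigmaBetti_apply, hx k, map_zero]

/-- The Chern character component `ch_k(F) ∈ H^k(X, Ω^k_X)`, read in `H^{2k}(X(ℂ); ℂ)`.
[cite: BuchweitzFlenner2003, §4 (before Def. 4.1) and §5] -/
def chernCharacterBetti (k : ℕ) : complexBetti X (2 * k) :=
  R.toBetti (show k + k = 2 * k by omega) (A.chernCharacter k)

/-- `ch_k(F)` is of Hodge type `(k, k)`. [cite: BuchweitzFlenner2003, §5 (first paragraph)] -/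
theorem isOfHodgeType_chernCharacterBetti (k : ℕ) :
    IsOfHodgeType n X (2 * k) k k (R.chernCharacterBetti A k) :=
  R.isOfHodgeType_toBetti _ _

end HodgeRealization

/-- **Semiregularity data of an `𝒪_X`-module `F`** on a complex variety `X` (intended: `X` smooth
projective of dimension `n`, `F` coherent, hence perfect — "every `𝒪_X`-module on a complex manifold
when considered as a complex concentrated in degree `0` is perfect"): BF's Atiyah–trace algebra of
`F` over `ℂ` (layer 1), ANCHORED to real carriers — `A^{2,0}` is Mathlib's `Ext²(F, F)` in the
abelian category `X.Modules` (`extEquiv`), and the targets `H^i(X, Ω^j_X)` are realised as the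
classes of Hodge type `(j, i)` in `H^{i+j}(X(ℂ); ℂ)` (`hodge`). Consumers take `D` as a parameter;
its intended instance (Atiyah class + Illusie trace + Dolbeault/GAGA) is a construction, not a
named fact. [cite: BuchweitzFlenner2003, Def. 4.1 and §4 (first paragraph) and §5 (first paragraph)] -/
structure SemiregularityData (n : ℕ) (X : Motives.SchemeOver ℂ) (F : X.left.Modules)
    extends AtiyahTraceAlgebra.{0, v} ℂ where
  /-- `A^{2,0} = Ext²_X(F, F)`, the obstruction space for deformations of `F` (Mathlib's `Ext` in
  `X.Modules`). [cite: BuchweitzFlenner2003, §1 ("the obstructions … live in Ext²_X(F,F)")] -/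
  extEquiv : Abelian.Ext F F 2 ≃+ Ext 2 0
  /-- `H^{i,j} = H^i(X, Ω^j_X) ≅ H^{j,i}(X) ⊆ H^{i+j}(X(ℂ); ℂ)`. [cite: VoisinHodgeI2002, Lemma 6.18] -/
  hodge : HodgeRealization.{v} n X Coh

namespace SemiregularityData

variable {n : ℕ} {X : Motives.SchemeOver ℂ} {F : X.left.Modules} (D : SemiregularityData.{v} n X F)

/-- **The `k`-th semiregularity map of `F` on real carriers**,
`σ_k : Ext²_X(F, F) → H^{k+2}(X, Ω^k_X) = H^{k,k+2}(X) ⊆ H^{2k+2}(X(ℂ); ℂ)`.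
[cite: BuchweitzFlenner2003, Def. 4.1] -/
def sigma (k : ℕ) : Abelian.Ext F F 2 →+ complexBetti X (2 * k + 2) :=
  (D.hodge.sigmaBetti D.toAtiyahTraceAlgebra k).toAddMonoidHom.comp D.extEquiv.toAddMonoidHom

/-- Unfolding: `σ_k(x)` is the realisation of `σ_k` of layer 1 at `extEquiv x`.
[cite: BuchweitzFlenner2003, Def. 4.1] -/
theorem sigma_apply (k : ℕ) (x : Abelian.Ext F F 2) :
    D.sigma k x = D.hodge.sigmaBetti D.toAtiyahTraceAlgebra k (D.extEquiv x) :=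
  rfl

/-- **The semiregularity map of `F` on real carriers**, `σ = (σ_k)_k : Ext²_X(F, F) → ∏_k H^{2k+2}(X(ℂ); ℂ)`.
[cite: BuchweitzFlenner2003, Def. 4.1] -/
def bettiSemiregularityMap : Abelian.Ext F F 2 →+ ((k : ℕ) → complexBetti X (2 * k + 2)) :=
  AddMonoidHom.pi fun k ↦ D.sigma k

/-- The `k`-th coordinate of `σ(x)` is `σ_k(x)`. [cite: BuchweitzFlenner2003, Def. 4.1] -/
@[simp]
theorem bettiSemiregularityMap_apply (x : Abelian.Ext F F 2) (k : ℕ) :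
    D.bettiSemiregularityMap x k = D.sigma k x :=
  rfl

/-- `σ_k(x) ∈ H^{2k+2}(X(ℂ); ℂ)` is of Hodge type `(k, k + 2)`. [cite: BuchweitzFlenner2003, §5 (first paragraph)] -/
theorem isOfHodgeType_sigma (k : ℕ) (x : Abelian.Ext F F 2) :
    IsOfHodgeType n X (2 * k + 2) k (k + 2) (D.sigma k x) :=
  D.hodge.isOfHodgeType_sigmaBetti _ k _

/-- **`F` is semiregular iff its semiregularity map on real carriers,
`Ext²_X(F, F) → ∏_k H^{2k+2}(X(ℂ); ℂ)`, is injective.** [cite: BuchweitzFlenner2003, Def. 4.1 and §7]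
[cite: Perry2026Semiregularity, Def. 2.4 and Rem. 2.5] -/
theorem isSemiregular_iff_injective :
    D.IsSemiregular ↔ Function.Injective D.bettiSemiregularityMap := by
  rw [D.hodge.isSemiregular_iff_sigmaBetti, injective_iff_map_eq_zero]
  constructor
  · intro h x hx
    exact D.extEquiv.map_eq_zero_iff.1 (h _ fun k ↦ by rw [← D.sigma_apply]; exact congrFun hx k)
  · intro h x hx
    obtain ⟨x, rfl⟩ := D.extEquiv.surjective x
    rw [h x (funext fun k ↦ hx k), map_zero]

/-- The Chern character component `ch_k(F) ∈ H^{2k}(X(ℂ); ℂ)` of `F`. [cite: BuchweitzFlenner2003, §4 and §5] -/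
def chernCharacterBetti (k : ℕ) : complexBetti X (2 * k) :=
  D.hodge.chernCharacterBetti D.toAtiyahTraceAlgebra k

/-- `ch_k(F)` is of Hodge type `(k, k)`. [cite: BuchweitzFlenner2003, §5 (first paragraph)] -/
theorem isOfHodgeType_chernCharacterBetti (k : ℕ) :
    IsOfHodgeType n X (2 * k) k k (D.chernCharacterBetti k) :=
  D.hodge.isOfHodgeType_chernCharacterBetti _ k

end SemiregularityData

/-- **Semiregularity data of a closed subscheme** `ι : Z ↪ X` of a complex variety `X` (intended:
`X` smooth projective of dimension `n`): BF's Atiyah–trace algebra of `𝒪_Z` with `T²_{Z/X}(𝒪_Z)`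
and `ε²` (layer 2), anchored to real carriers — `A^{2,0}` is Mathlib's `Ext²_X(ι_*𝒪_Z, ι_*𝒪_Z)`
(`Scheme.Modules.pushforward`), the targets are realised in `H^•(X(ℂ); ℂ)` by Hodge type.
[cite: BuchweitzFlenner2003, Def. 4.10 and (8.1) and Prop. 8.2] -/
structure SubschemeSemiregularityData (n : ℕ) (X : Motives.SchemeOver ℂ) {Z : Scheme.{0}}
    (ι : Z ⟶ X.left) [IsClosedImmersion ι] extends SubspaceAtiyahTraceAlgebra.{0, v} ℂ where
  /-- `A^{2,0} = Ext²_X(𝒪_Z, 𝒪_Z)` (`𝒪_Z` as the `𝒪_X`-module `ι_* 𝒪_Z`). [cite: BuchweitzFlenner2003, Def. 4.10] -/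
  extEquiv : Abelian.Ext ((Scheme.Modules.pushforward ι).obj (SheafOfModules.unit Z.ringCatSheaf))
    ((Scheme.Modules.pushforward ι).obj (SheafOfModules.unit Z.ringCatSheaf)) 2 ≃+ Ext 2 0
  /-- `H^{i,j} = H^i(X, Ω^j_X) ≅ H^{j,i}(X) ⊆ H^{i+j}(X(ℂ); ℂ)`. [cite: VoisinHodgeI2002, Lemma 6.18] -/
  hodge : HodgeRealization.{v} n X Coh

namespace SubschemeSemiregularityData

variable {n : ℕ} {X : Motives.SchemeOver ℂ} {Z : Scheme.{0}} {ι : Z ⟶ X.left} [IsClosedImmersion ι]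
  (D : SubschemeSemiregularityData.{v} n X ι)

/-- **Bloch's semiregularity map on real carriers** (form degree `q`; codimension `p = q + 1` in the
lci case, where `T²_{Z/X}(𝒪_Z) = H¹(Z, N_{Z/X})`):
`π_Z : T²_{Z/X}(𝒪_Z) → H^{q+2}(X, Ω^q_X) = H^{q,q+2}(X) ⊆ H^{2q+2}(X(ℂ); ℂ)`.
[cite: BuchweitzFlenner2003, (8.1)(2) and Prop. 8.2] [cite: Bloch1972Semiregularity, §4–§6 (cite-only)] -/
def bettiBlochSemiregularityMap (q : ℕ) : D.T2 →ₗ[ℂ] complexBetti X (2 * q + 2) :=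
  D.hodge.toBetti (show q + (q + 2) = 2 * q + 2 by omega) ∘ₗ D.blochSemiregularityMap q

/-- `π_Z(t)` is of Hodge type `(q, q + 2) = (p - 1, p + 1)`. [cite: BuchweitzFlenner2003, §5 (first paragraph) and (8.1)] -/
theorem isOfHodgeType_bettiBlochSemiregularityMap (q : ℕ) (t : D.T2) :
    IsOfHodgeType n X (2 * q + 2) q (q + 2) (D.bettiBlochSemiregularityMap q t) :=
  D.hodge.isOfHodgeType_toBetti _ _

/-- `Z` is Bloch-semiregular iff `π_Z` read in `H^{2q+2}(X(ℂ); ℂ)` is injective.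
[cite: BuchweitzFlenner2003, Prop. 8.2] [cite: BandieraLepriManetti2023, §1] -/
theorem isBlochSemiregular_iff (q : ℕ) :
    D.IsBlochSemiregular q ↔ Function.Injective (D.bettiBlochSemiregularityMap q) := by
  refine ⟨fun h ↦ (D.hodge.injective_toBetti _).comp h, fun h ↦ ?_⟩
  exact Function.Injective.of_comp (f := D.hodge.toBetti (show q + (q + 2) = 2 * q + 2 by omega)) h

/-- The class `ch_p(𝒪_Z) ∈ H^{2p}(X(ℂ); ℂ)` — for `Z` of codimension `p` the fundamental class `[Z]`
("according to Grothendieck […] `[Z] = ((-1)^{p-1}/(p-1)!) c_p(𝒪_Z) = ch_p(𝒪_Z)`"), of Hodge type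
`(p, p)`. [cite: BuchweitzFlenner2003, Cor. 4.12 (proof)] -/
def chernCharacterBetti (p : ℕ) : complexBetti X (2 * p) :=
  D.hodge.chernCharacterBetti D.toAtiyahTraceAlgebra p

/-- `ch_p(𝒪_Z)` is of Hodge type `(p, p)`. [cite: BuchweitzFlenner2003, Cor. 4.12 and §5] -/
theorem isOfHodgeType_chernCharacterBetti (p : ℕ) :
    IsOfHodgeType n X (2 * p) p p (D.chernCharacterBetti p) :=
  D.hodge.isOfHodgeType_chernCharacterBetti _ p

end SubschemeSemiregularityData

end HodgeTheory

end Literature.AlgebraicGeometry.HodgeTheory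

end
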